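import Mathlib
import HarnessLib
import Summits.QuantumAdvantage.QuantumAdvantage.Theorems.GapLawB
import Summits.QuantumAdvantage.QuantumAdvantage.Theorems.CharDialSegmentMovesA

/-!
# The DOMINO LAW, part A: parity immunity, the pair calculus, domino cubes (lens 4 g26, node 4)

Part A of the five-part tree landing of the cell node `DominoLaw.lean` (decomp-qadv lens 4 «minimal counterexample», g26; node
docstring = the full account).  §1 immunity of a parity class (Beck–Li 2013 Thm 5.2, `q = 2`, the tree's
`eq_zero_of_lowDegOn_of_forall_dvd_hwt` BY NAME); §2 two inputs differing by the orientation of one weight-one pair have the same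
walk except at the middle cut (`walkExp_pair_eq`, `walkExp_mid`; window counts `SegMove.wseg` BY NAME); §3 the domino cube `dom a u o`
(disjoint dominoes at positions `a_i`, `a_{i+1} ≥ a_i + 2`, glued into a background), degree-preserving (`comp_dom_mem_lowDeg`), walk
off the middle cuts independent of the orientations (`walkExp_dom_indep`).  Supports stmt-QuantumAdvantage-28487 (record; the
residual `X = AbsorptionDial.NoPerfectPolyOdd` is NOT claimed).  Theses-free; no `sorry`; no instances, no notation.
-/

set_option autoImplicit false
set_option linter.dupNamespace false

namespace Summit.QuantumAdvantage.QuantumAdvantage.Theorems.DominoLaw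
open Classical
open Finset
open Summit.QuantumAdvantage.AdviceFreeQNC0
open Summit.QuantumAdvantage.AdviceFreeQNC0.JLinPeel
open Summit.QuantumAdvantage.QuantumAdvantage.Theorems.PhaseParity
open Summit.QuantumAdvantage.QuantumAdvantage.Theorems.GapLaw
open Literature.Computability.MetaComplexity Literature.Computability.MetaComplexity.Smolensky

/-! ### §1 Immunity of a parity class (Beck–Li 2013, Theorem 5.2 with `q = 2`, by name) -/

section Immunity

variable {F : Type*} [Field F] {k : ℕ}

/-- **Immunity of one parity class**: over a field with `2 ≠ 0`, a function of degree `≤ D` on `{0,1}ᵏ`, `2D + 1 ≤ k`,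
vanishing at every `o` with `|o| ≡ r (mod 2)` is zero (`eq_zero_of_lowDegOn_of_forall_dvd_hwt` with `q = 2`). -/
theorem eq_zero_of_lowDeg_vanish_parity (h2 : (2 : F) ≠ 0) {D : ℕ} (r : ℕ) (hD : 2 * D + 1 ≤ k)
    {g : CubeFn F k} (hg : g ∈ lowDeg F k D) (hvan : ∀ o : Fin k → Bool, wt o % 2 = r % 2 → g o = 0) :
    g = 0 := by
  have h2' : ((2 : ℕ) : F) ≠ 0 := by exact_mod_cast h2
  rw [lowDeg_eq_lowDegOn] at hg
  refine eq_zero_of_lowDegOn_of_forall_dvd_hwt h2' D (2 - r % 2) (fun ℓ hℓ => ?_) g hg (fun x hx => ?_)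
  · refine ⟨ℓ + (ℓ + (2 - r % 2)) % 2, ?_, ?_, ?_⟩
    · omega
    · omega
    · rw [Fintype.card_fin]
      omega
  · have hw : hwt x = wt x := rfl
    rw [hw] at hx
    exact hvan x (by omega)

end Immunity

/-! ### §2 Two inputs that differ by the orientation of one weight-one pair -/

section Pair

variable {n : ℕ}

/-- `W_h(v)` as a sum of indicators. -/
theorem wtPrefix_eq_sum (v : Fin n → Bool) (h : ℕ) :
    wtPrefix v h = ∑ t, (if t.val < h ∧ v t = true then 1 else 0) := by
  unfold wtPrefix; rw [Finset.card_filter]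

/-- Splitting a sum over `Fin n` at the two positions `a`, `a + 1`. -/
theorem sum_split_pair (a : ℕ) (ha : a + 2 ≤ n) (f : Fin n → ℕ) :
    ∑ t, f t = f ⟨a, by omega⟩ + f ⟨a + 1, by omega⟩ +
      ∑ t ∈ (univ.erase (⟨a, by omega⟩ : Fin n)).erase ⟨a + 1, by omega⟩, f t := by
  have hB : (⟨a + 1, by omega⟩ : Fin n) ∈ univ.erase (⟨a, by omega⟩ : Fin n) := by
    refine Finset.mem_erase.2 ⟨fun h => ?_, mem_univ _⟩
    have := Fin.mk.inj_iff.1 h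
    omega
  rw [← Finset.add_sum_erase univ f (mem_univ (⟨a, by omega⟩ : Fin n)), ← Finset.add_sum_erase _ f hB, add_assoc]

/-- Members of the doubly-erased index set are off the pair. -/
theorem val_ne_of_mem_erase_erase {a : ℕ} (ha : a + 2 ≤ n) {t : Fin n}
    (ht : t ∈ (univ.erase (⟨a, by omega⟩ : Fin n)).erase ⟨a + 1, by omega⟩) : t.val ≠ a ∧ t.val ≠ a + 1 := by
  rw [Finset.mem_erase, Finset.mem_erase] at ht
  refine ⟨fun h => ht.2.1 (Fin.ext h), fun h => ht.1 (Fin.ext h)⟩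

/-- the one-position window count `w[a, a+1) = [v_a]` (window counts `SegMove.wseg`, tree part CharDialSegmentMovesA, BY NAME;
the prefix-weight recursion itself is the tree's `PairFreezing.wtPrefix_succ` / `SegMove.walkExp_add_wseg`, not restated). -/
theorem wseg_single (v : Fin n → Bool) (a : ℕ) (ha : a < n) :
    SegMove.wseg v a (a + 1) = if v ⟨a, ha⟩ = true then 1 else 0 := by
  unfold SegMove.wseg
  by_cases hv : v ⟨a, ha⟩ = true
  · rw [if_pos hv, Finset.card_eq_one]
    refine ⟨⟨a, ha⟩, ?_⟩
    ext t
    simp only [Finset.mem_filter, Finset.mem_univ, true_and, Finset.mem_singleton]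
    constructor
    · rintro ⟨⟨h1, h2⟩, _⟩
      exact Fin.ext (show t.val = a by omega)
    · intro ht
      subst ht
      exact ⟨⟨le_rfl, Nat.lt_succ_self a⟩, hv⟩
  · rw [if_neg hv, Finset.card_eq_zero, Finset.filter_eq_empty_iff]
    rintro t - ⟨⟨h1, h2⟩, h3⟩
    have ht : t = ⟨a, ha⟩ := Fin.ext (show t.val = a by omega)
    subst ht
    exact hv h3

variable (a : ℕ) (ha : a + 2 ≤ n) (v v' : Fin n → Bool)

/-- Two inputs agreeing off the pair `{a, a+1}`, each with exactly one `1` on the pair, have the same weight. -/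
theorem wt_pair_eq (hoff : ∀ t : Fin n, t.val ≠ a → t.val ≠ a + 1 → v t = v' t)
    (hv : v ⟨a + 1, by omega⟩ = !v ⟨a, by omega⟩) (hv' : v' ⟨a + 1, by omega⟩ = !v' ⟨a, by omega⟩) :
    wt v = wt v' := by
  unfold wt
  rw [Finset.card_filter, Finset.card_filter, sum_split_pair a ha, sum_split_pair a ha]
  have hrest : ∑ t ∈ (univ.erase (⟨a, by omega⟩ : Fin n)).erase ⟨a + 1, by omega⟩, (if v t = true then 1 else 0) =
      ∑ t ∈ (univ.erase (⟨a, by omega⟩ : Fin n)).erase ⟨a + 1, by omega⟩, (if v' t = true then 1 else 0) := by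
    refine Finset.sum_congr rfl fun t ht => ?_
    obtain ⟨h1, h2⟩ := val_ne_of_mem_erase_erase ha ht
    rw [hoff t h1 h2]
  have e1 : (if v ⟨a, by omega⟩ = true then 1 else 0) + (if v ⟨a + 1, by omega⟩ = true then 1 else 0) = 1 := by
    rw [hv]; cases v ⟨a, by omega⟩ <;> simp
  have e2 : (if v' ⟨a, by omega⟩ = true then 1 else 0) + (if v' ⟨a + 1, by omega⟩ = true then 1 else 0) = 1 := by
    rw [hv']; cases v' ⟨a, by omega⟩ <;> simp
  rw [hrest]
  omega

/-- … and the same prefix weight at every cut other than the middle cut `a + 1`. -/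
theorem wtPrefix_pair_eq (hoff : ∀ t : Fin n, t.val ≠ a → t.val ≠ a + 1 → v t = v' t)
    (hv : v ⟨a + 1, by omega⟩ = !v ⟨a, by omega⟩) (hv' : v' ⟨a + 1, by omega⟩ = !v' ⟨a, by omega⟩)
    {h : ℕ} (hh : h ≠ a + 1) : wtPrefix v h = wtPrefix v' h := by
  rw [wtPrefix_eq_sum, wtPrefix_eq_sum, sum_split_pair a ha, sum_split_pair a ha]
  have hrest : ∑ t ∈ (univ.erase (⟨a, by omega⟩ : Fin n)).erase ⟨a + 1, by omega⟩,
        (if t.val < h ∧ v t = true then 1 else 0) =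
      ∑ t ∈ (univ.erase (⟨a, by omega⟩ : Fin n)).erase ⟨a + 1, by omega⟩,
        (if t.val < h ∧ v' t = true then 1 else 0) := by
    refine Finset.sum_congr rfl fun t ht => ?_
    obtain ⟨h1, h2⟩ := val_ne_of_mem_erase_erase ha ht
    rw [hoff t h1 h2]
  rw [hrest]
  by_cases hle : h ≤ a
  · have hA : ¬ ((⟨a, by omega⟩ : Fin n).val < h) := by show ¬ (a < h); omega
    have hB : ¬ ((⟨a + 1, by omega⟩ : Fin n).val < h) := by show ¬ (a + 1 < h); omega
    simp only [hA, hB, false_and, if_false]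
  · have hA : ((⟨a, by omega⟩ : Fin n).val < h) := by show a < h; omega
    have hB : ((⟨a + 1, by omega⟩ : Fin n).val < h) := by show a + 1 < h; omega
    simp only [hA, hB, true_and]
    have e1 : (if v ⟨a, by omega⟩ = true then 1 else 0) + (if v ⟨a + 1, by omega⟩ = true then 1 else 0) = 1 := by
      rw [hv]; cases v ⟨a, by omega⟩ <;> simp
    have e2 : (if v' ⟨a, by omega⟩ = true then 1 else 0) + (if v' ⟨a + 1, by omega⟩ = true then 1 else 0) = 1 := by
      rw [hv']; cases v' ⟨a, by omega⟩ <;> simp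
    omega

/-- At the middle cut the prefix weights differ by the first bits: `W_{a+1}(v) + [v'_a] = W_{a+1}(v') + [v_a]`. -/
theorem wtPrefix_pair_mid (hoff : ∀ t : Fin n, t.val ≠ a → t.val ≠ a + 1 → v t = v' t) :
    wtPrefix v (a + 1) + (if v' ⟨a, by omega⟩ = true then 1 else 0) =
      wtPrefix v' (a + 1) + (if v ⟨a, by omega⟩ = true then 1 else 0) := by
  rw [wtPrefix_eq_sum, wtPrefix_eq_sum, sum_split_pair a ha, sum_split_pair a ha]
  have hrest : ∑ t ∈ (univ.erase (⟨a, by omega⟩ : Fin n)).erase ⟨a + 1, by omega⟩,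
        (if t.val < a + 1 ∧ v t = true then 1 else 0) =
      ∑ t ∈ (univ.erase (⟨a, by omega⟩ : Fin n)).erase ⟨a + 1, by omega⟩,
        (if t.val < a + 1 ∧ v' t = true then 1 else 0) := by
    refine Finset.sum_congr rfl fun t ht => ?_
    obtain ⟨h1, h2⟩ := val_ne_of_mem_erase_erase ha ht
    rw [hoff t h1 h2]
  rw [hrest]
  have hA : ((⟨a, by omega⟩ : Fin n).val < a + 1) := by show a < a + 1; omega
  have hB : ¬ ((⟨a + 1, by omega⟩ : Fin n).val < a + 1) := by show ¬ (a + 1 < a + 1); omega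
  simp only [hA, hB, true_and, false_and, if_false]
  omega

/-- The walk exponent `e_h = |v| + W_h(v)` agrees at every cut `h ≠ a + 1`. -/
theorem walkExp_pair_eq (hoff : ∀ t : Fin n, t.val ≠ a → t.val ≠ a + 1 → v t = v' t)
    (hv : v ⟨a + 1, by omega⟩ = !v ⟨a, by omega⟩) (hv' : v' ⟨a + 1, by omega⟩ = !v' ⟨a, by omega⟩)
    {h : ℕ} (hh : h ≠ a + 1) : walkExp v h = walkExp v' h := by
  unfold walkExp
  rw [wt_pair_eq a ha v v' hoff hv hv', wtPrefix_pair_eq a ha v v' hoff hv hv' hh]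

/-- At the middle cut: `e_{a+1}(v) = e_a(v) + [v_a]` with `e_a(v) = e_a(v')`. -/
theorem walkExp_mid (hoff : ∀ t : Fin n, t.val ≠ a → t.val ≠ a + 1 → v t = v' t)
    (hv : v ⟨a + 1, by omega⟩ = !v ⟨a, by omega⟩) (hv' : v' ⟨a + 1, by omega⟩ = !v' ⟨a, by omega⟩) :
    walkExp v (a + 1) = walkExp v' a + (if v ⟨a, by omega⟩ = true then 1 else 0) := by
  rw [SegMove.walkExp_add_wseg v (Nat.le_succ a), wseg_single v a (by omega),
    walkExp_pair_eq a ha v v' hoff hv hv' (show a ≠ a + 1 by omega)]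

end Pair

/-! ### §3 The domino cube -/

section Cube

variable {n k : ℕ} (a : Fin k → ℕ) (hsep : ∀ i j : Fin k, i < j → a i + 2 ≤ a j) (hbd : ∀ i, a i + 2 ≤ n)

/-- `k` disjoint dominoes at positions `a_i` (pairwise `a_j ≥ a_i + 2`) with orientations `o`, glued into the background
`u`: bit `a_i ↦ o_i`, bit `a_i + 1 ↦ ¬o_i`, every other bit from `u`. -/
noncomputable def dom (u : Fin n → Bool) (o : Fin k → Bool) : Fin n → Bool := fun t =>
  if h : ∃ i, a i = t.val then o (Classical.choose h)
  else if h' : ∃ i, a i + 1 = t.val then !o (Classical.choose h')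
  else u t

include hsep in
/-- Separated positions are distinct. -/
theorem pos_injective {i j : Fin k} (hij : a i = a j) : i = j := by
  rcases lt_trichotomy i j with h | h | h
  · have := hsep i j h; omega
  · exact h
  · have := hsep j i h; omega

include hsep in
/-- No domino starts where another one's second bit sits. -/
theorem pos_succ_ne (i j : Fin k) : a i + 1 ≠ a j := by
  rcases lt_trichotomy i j with h | h | h
  · have := hsep i j h; omega
  · subst h; omega
  · have := hsep j i h; omega

include hsep in
/-- First bit of domino `i`. -/
theorem dom_fst (u : Fin n → Bool) (o : Fin k → Bool) (i : Fin k) (hi : a i < n) :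
    dom a u o ⟨a i, hi⟩ = o i := by
  have h : ∃ j, a j = a i := ⟨i, rfl⟩
  simp only [dom, dif_pos h]
  congr 1
  exact pos_injective a hsep (Classical.choose_spec h)

include hsep in
/-- Second bit of domino `i`. -/
theorem dom_snd (u : Fin n → Bool) (o : Fin k → Bool) (i : Fin k) (hi : a i + 1 < n) :
    dom a u o ⟨a i + 1, hi⟩ = !o i := by
  have hn : ¬ ∃ j, a j = a i + 1 := fun ⟨j, hj⟩ => pos_succ_ne a hsep i j hj.symm
  have h' : ∃ j, a j + 1 = a i + 1 := ⟨i, rfl⟩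
  simp only [dom, dif_neg hn, dif_pos h']
  congr 2
  exact pos_injective a hsep (by have := Classical.choose_spec h'; omega)

/-- Off the dominoes the cube reads the background. -/
theorem dom_off (u : Fin n → Bool) (o : Fin k → Bool) (t : Fin n) (h1 : ∀ i, a i ≠ t.val)
    (h2 : ∀ i, a i + 1 ≠ t.val) : dom a u o t = u t := by
  have hn : ¬ ∃ i, a i = t.val := fun ⟨i, hi⟩ => h1 i hi
  have hn' : ¬ ∃ i, a i + 1 = t.val := fun ⟨i, hi⟩ => h2 i hi
  simp only [dom, dif_neg hn, dif_neg hn']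

/-- Changing the orientation of domino `i` changes nothing off the pair `{a_i, a_i + 1}`. -/
theorem dom_update_off (u : Fin n → Bool) (o : Fin k → Bool) (i : Fin k) (b : Bool) (t : Fin n)
    (ht1 : t.val ≠ a i) (ht2 : t.val ≠ a i + 1) : dom a u (Function.update o i b) t = dom a u o t := by
  by_cases h : ∃ j, a j = t.val
  · have hj : Classical.choose h ≠ i := fun e => ht1 (by rw [← Classical.choose_spec h, e])
    simp only [dom, dif_pos h, Function.update_of_ne hj]
  · by_cases h' : ∃ j, a j + 1 = t.val
    · have hj : Classical.choose h' ≠ i := fun e => ht2 (by rw [← Classical.choose_spec h', e])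
      simp only [dom, dif_neg h, dif_pos h', Function.update_of_ne hj]
    · simp only [dom, dif_neg h, dif_neg h']

include hsep hbd in
/-- **Restriction to the domino cube keeps the degree**: each coordinate of `o ↦ dom a u o` is `o_i`, `¬o_i` or constant. -/
theorem comp_dom_mem_lowDeg {F : Type*} [Field F] (u : Fin n → Bool) {D : ℕ} {f : CubeFn F n}
    (hf : f ∈ lowDeg F n D) : (fun o => f (dom a u o)) ∈ lowDeg F k D := by
  refine comp_mem_lowDeg_of_coord (dom a u) (fun t => ?_) hf
  by_cases h : ∃ j, a j = t.val
  · obtain ⟨j, hj⟩ := h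
    have ht : t = ⟨a j, by have := hbd j; omega⟩ := Fin.ext hj.symm
    have e : (fun o : Fin k → Bool => if dom a u o t = true then (1 : F) else 0) = mono F {j} := by
      funext o
      rw [ht, dom_fst a hsep]
      unfold mono
      rw [Finset.prod_singleton]
    rw [e]
    exact mono_mem_lowDeg (by simp)
  · by_cases h' : ∃ j, a j + 1 = t.val
    · obtain ⟨j, hj⟩ := h'
      have ht : t = ⟨a j + 1, by have := hbd j; omega⟩ := Fin.ext hj.symm
      have e : (fun o : Fin k → Bool => if dom a u o t = true then (1 : F) else 0) = 1 - mono F {j} := by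
        funext o
        rw [ht, dom_snd a hsep, Pi.sub_apply, Pi.one_apply]
        unfold mono
        rw [Finset.prod_singleton]
        cases o j <;> simp
      rw [e]
      exact Submodule.sub_mem _ (one_mem_lowDeg 1) (mono_mem_lowDeg (by simp))
    · have e : (fun o : Fin k → Bool => if dom a u o t = true then (1 : F) else 0) =
          fun _ => if u t = true then (1 : F) else 0 := by
        funext o
        rw [dom_off a u o t (fun i hi => h ⟨i, hi⟩) (fun i hi => h' ⟨i, hi⟩)]
      rw [e]
      by_cases hu : u t = true
      · simp only [hu, if_true]
        exact one_mem_lowDeg 1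
      · simp only [hu]
        exact Submodule.zero_mem _

include hsep hbd in
/-- One orientation flip, seen by the walk: every cut except the middle cut `a_i + 1` keeps its exponent. -/
theorem walkExp_dom_update (u : Fin n → Bool) (o : Fin k → Bool) (i : Fin k) (b : Bool) {h : ℕ}
    (hh : h ≠ a i + 1) : walkExp (dom a u (Function.update o i b)) h = walkExp (dom a u o) h := by
  have hi := hbd i
  refine walkExp_pair_eq (a i) hi _ _ (fun t h1 h2 => dom_update_off a u o i b t h1 h2) ?_ ?_ hh
  · rw [dom_fst a hsep, dom_snd a hsep, Function.update_self]
  · rw [dom_fst a hsep, dom_snd a hsep]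

include hsep hbd in
/-- … and the middle cut's exponent is `e_{a_i}(u) + [o_i]` with `e_{a_i}` orientation-free. -/
theorem walkExp_dom_mid (u : Fin n → Bool) (o : Fin k → Bool) (i : Fin k) (b : Bool) :
    walkExp (dom a u (Function.update o i b)) (a i + 1) = walkExp (dom a u o) (a i) + (if b = true then 1 else 0) := by
  have hi := hbd i
  have e := walkExp_mid (a i) hi (dom a u (Function.update o i b)) (dom a u o)
    (fun t h1 h2 => dom_update_off a u o i b t h1 h2) ?_ ?_
  · rw [e, dom_fst a hsep, Function.update_self]
  · rw [dom_fst a hsep, dom_snd a hsep, Function.update_self]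
  · rw [dom_fst a hsep, dom_snd a hsep]

include hsep hbd in
/-- The middle cut's exponent at the current orientation. -/
theorem walkExp_dom_mid_self (u : Fin n → Bool) (o : Fin k → Bool) (i : Fin k) :
    walkExp (dom a u o) (a i + 1) = walkExp (dom a u o) (a i) + (if o i = true then 1 else 0) := by
  have e := walkExp_dom_mid a hsep hbd u o i (o i)
  rwa [Function.update_eq_self] at e

include hsep hbd in
/-- Orientation changes never move the exponent of a cut that is no middle cut. -/
theorem walkExp_dom_indep (u : Fin n → Bool) {h : ℕ} (hh : ∀ i, a i + 1 ≠ h) :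
    ∀ (d : ℕ) (o o' : Fin k → Bool), (univ.filter fun i => o i ≠ o' i).card = d →
      walkExp (dom a u o) h = walkExp (dom a u o') h := by
  intro d
  induction d with
  | zero =>
    intro o o' hd
    have hoo : o = o' := by
      funext i
      by_contra hne
      have : i ∈ (univ.filter fun i => o i ≠ o' i) := Finset.mem_filter.2 ⟨mem_univ _, hne⟩
      rw [Finset.card_eq_zero.1 hd] at this
      exact Finset.notMem_empty _ this
    rw [hoo]
  | succ d ih =>
    intro o o' hd
    obtain ⟨i, hi⟩ : (univ.filter fun i => o i ≠ o' i).Nonempty := by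
      rw [← Finset.card_pos, hd]; omega
    have hio : o i ≠ o' i := (Finset.mem_filter.1 hi).2
    set o'' := Function.update o i (o' i) with ho''
    have hcard : (univ.filter fun j => o'' j ≠ o' j).card = d := by
      have hset : (univ.filter fun j => o'' j ≠ o' j) = (univ.filter fun j => o j ≠ o' j).erase i := by
        ext j
        simp only [Finset.mem_filter, Finset.mem_univ, true_and, Finset.mem_erase, ho'']
        by_cases hji : j = i
        · subst hji; simp
        · rw [Function.update_of_ne hji]; simp [hji]
      rw [hset, Finset.card_erase_of_mem hi, hd]
      rfl
    rw [← ih o'' o' hcard, ho'', walkExp_dom_update a hsep hbd u o i (o' i) (hh i).symm]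

end Cube

end Summit.QuantumAdvantage.QuantumAdvantage.Theorems.DominoLaw
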